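import Literature.Geometry.DiscreteGeometry.ShellCensusSearchFrame
import HarnessLib

/-!
# Soundness of the census growth search, part B: realized states and Phase 1

Topic `Literature/Geometry/DiscreteGeometry`.  The semantics `Realizes M φ s` of a Phase-1 state
of the checker `ShellCensusSearchCheck.lean` (an injective partial labelling `φ` of the abstract
frame `M : CF` under which the placed triangles are triangles of `M`, closed labels have their
whole star placed, the root label `0` has minimum star size `m0`), the realized root, and the
completeness of one growth step: a realized state with an open side has a realized child.
-/

namespace Literature.Geometry.DiscreteGeometry

namespace ShellCensusSearch

open Finset

/-! ### Program lemmas -/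

/-- The left fold over `range'` is this checker's `foldRange`. [folklore] -/
theorem foldRange_eq {β : Type} (f : β → ℕ → β) (lo k : ℕ) (acc : β) :
    (List.range' lo k).foldl f acc = foldRange f lo k acc := by
  induction k generalizing lo acc with
  | zero => simp [foldRange]
  | succ k ih => rw [foldRange, List.range'_succ, List.foldl_cons, ih]

/-- Reading after a guarded write. [folklore] -/
theorem getD_setIfInBounds (A : Array ℕ) {i : ℕ} (j x d : ℕ) (hi : i < A.size) :
    (A.setIfInBounds i x).getD j d = if j = i then x else A.getD j d := by
  simp only [Array.getD_eq_getD_getElem?, Array.getElem?_setIfInBounds, hi, ↓reduceIte]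
  by_cases h : i = j
  · subst h; simp
  · simp [h, Ne.symm h]

/-- Reading a constant array. [folklore] -/
theorem getD_replicate (n d j : ℕ) : (Array.replicate n d : Array ℕ).getD j d = d := by
  simp only [Array.getD_eq_getD_getElem?, Array.getElem?_replicate]; split <;> simp

/-- The placed list after `addTri`. [folklore] -/
theorem addTri_toList (s : St) (p q r : ℕ) : (s.addTri p q r).tris.toList = s.tris.toList ++ [sortTri p q r] := by
  simp [St.addTri]

/-- The filter of the placed list at a label is this checker's `trisAt`. [folklore] -/
theorem trisAt_eq (s : St) (v : ℕ) : (s.tris.toList.filter fun t => tmem t v) = s.trisAt v := by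
  unfold St.trisAt
  rw [← Array.foldr_toList]
  induction s.tris.toList with
  | nil => rfl
  | cons t l ih =>
    simp only [List.foldr_cons, List.filter_cons]
    split <;> simp_all

/-- `placed` is membership of the sorted code. [folklore] -/
theorem placed_iff (s : St) (a b c : ℕ) : s.placed a b c = true ↔ sortTri a b c ∈ s.tris.toList := by
  simp [St.placed]

/-- Membership in `link`. [folklore] -/
theorem mem_link (s : St) (v u : ℕ) : u ∈ s.link v ↔ u < s.n ∧ u ≠ v ∧ s.gsc v u ≠ 0 := by
  simp [St.link]

/-- This checker's side count is symmetric in its two labels. [folklore] -/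
theorem gsc_comm (s : St) (a b : ℕ) : s.gsc b a = s.gsc a b := by
  unfold St.gsc; congr 1; apply List.filter_congr; intro t _; rw [Bool.and_comm]

/-- A positive side count yields a placed triangle through both labels. [folklore] -/
theorem exists_of_gsc_ne_zero {s : St} {a b : ℕ} (h : s.gsc a b ≠ 0) :
    ∃ t ∈ s.tris.toList, tmem t a = true ∧ tmem t b = true := by
  unfold St.gsc at h
  obtain ⟨t, ht⟩ := List.exists_mem_of_length_pos (Nat.pos_of_ne_zero h)
  rw [List.mem_filter, Bool.and_eq_true] at ht
  exact ⟨t, ht.1, ht.2.1, ht.2.2⟩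

/-- A placed triangle through both labels gives a positive side count. [folklore] -/
theorem gsc_ne_zero_of_mem {s : St} {a b t : ℕ} (ht : t ∈ s.tris.toList) (ha : tmem t a = true) (hb : tmem t b = true) :
    s.gsc a b ≠ 0 := by
  unfold St.gsc
  apply Nat.pos_iff_ne_zero.1
  apply List.length_pos_of_mem (a := t)
  rw [List.mem_filter]; exact ⟨ht, by simp [ha, hb]⟩

/-! ### Realized states -/

namespace Realizes

variable {M : CF} {φ : ℕ → Fin 12} {s : St}

/-- Labels of placed codes are used. [folklore] -/
theorem lt_n (h : Realizes M φ s) {t v : ℕ} (ht : t ∈ s.tris.toList) (hv : v ∈ lset t) : v < s.n :=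
  lt_of_mem_lset (h.valid t ht) hv

/-- The image of a placed code has three elements. [folklore] -/
theorem card_tset (h : Realizes M φ s) {t : ℕ} (ht : t ∈ s.tris.toList) : (tset φ t).card = 3 := by
  unfold tset
  rw [card_image_of_injOn, card_lset (h.valid t ht)]
  intro a ha b hb hab
  exact h.inj a b (h.lt_n ht (by simpa using ha)) (h.lt_n ht (by simpa using hb)) hab

/-- Membership in the image triangle. [folklore] -/
theorem mem_tset_iff (h : Realizes M φ s) {t : ℕ} (ht : t ∈ s.tris.toList) {v : ℕ} (hv : v < s.n) :
    φ v ∈ tset φ t ↔ v ∈ lset t := by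
  unfold tset
  rw [mem_image]
  constructor
  · rintro ⟨w, hw, he⟩
    rwa [← h.inj w v (h.lt_n ht hw) hv he]
  · intro hv'; exact ⟨v, hv', rfl⟩

/-- Elements of an image triangle are images of its labels. [folklore] -/
theorem exists_label_of_mem_tset {t : ℕ} {x : Fin 12} (hx : x ∈ tset φ t) : ∃ w ∈ lset t, φ w = x := by
  unfold tset at hx; simpa using hx

/-- **Placed codes with the same image are equal.** [folklore] -/
theorem eq_of_tset_eq (h : Realizes M φ s) {t t' : ℕ} (ht : t ∈ s.tris.toList) (ht' : t' ∈ s.tris.toList)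
    (he : tset φ t = tset φ t') : t = t' := by
  apply triValid_ext (h.valid t ht) (h.valid t' ht')
  ext v
  constructor
  · intro hv
    have := (h.mem_tset_iff ht (h.lt_n ht hv)).2 hv
    rw [he] at this
    exact (h.mem_tset_iff ht' (h.lt_n ht hv)).1 this
  · intro hv
    have := (h.mem_tset_iff ht' (h.lt_n ht' hv)).2 hv
    rw [← he] at this
    exact (h.mem_tset_iff ht (h.lt_n ht' hv)).1 this

/-- The side count of two used labels is at most two. [folklore] -/
theorem gsc_le_two (h : Realizes M φ s) {a b : ℕ} (ha : a < s.n) (hb : b < s.n) (hab : a ≠ b) : s.gsc a b ≤ 2 := by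
  by_contra hlt
  push Not at hlt
  unfold St.gsc at hlt
  set L := s.tris.toList.filter fun t => tmem t a && tmem t b with hL
  have hnd : L.Nodup := h.nodup.filter _
  -- three distinct elements
  have h0 : 0 < L.length := by omega
  have h1 : 1 < L.length := by omega
  have h2 : 2 < L.length := by omega
  have hm : ∀ i (hi : i < L.length), L[i] ∈ s.tris.toList ∧ tmem L[i] a = true ∧ tmem L[i] b = true := by
    intro i hi
    have hx := List.mem_filter.1 (List.getElem_mem hi)
    rw [Bool.and_eq_true] at hx
    exact ⟨hx.1, hx.2.1, hx.2.2⟩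
  have hφ : φ a ≠ φ b := fun he => hab (h.inj a b ha hb he)
  have key : ∀ i (hi : i < L.length), tset φ L[i] ∈ M.tri ∧ φ a ∈ tset φ L[i] ∧ φ b ∈ tset φ L[i] := by
    intro i hi
    obtain ⟨hm1, hma, hmb⟩ := hm i hi
    exact ⟨h.mem _ hm1, (h.mem_tset_iff hm1 ha).2 (tmem_iff.1 hma), (h.mem_tset_iff hm1 hb).2 (tmem_iff.1 hmb)⟩
  obtain ⟨k0, k0a, k0b⟩ := key 0 h0
  obtain ⟨k1, k1a, k1b⟩ := key 1 h1
  obtain ⟨k2, k2a, k2b⟩ := key 2 h2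
  have d01 : L[0] ≠ L[1] := fun he => by have := (hnd.getElem_inj_iff).1 he; omega
  have d02 : L[0] ≠ L[2] := fun he => by have := (hnd.getElem_inj_iff).1 he; omega
  have d12 : L[1] ≠ L[2] := fun he => by have := (hnd.getElem_inj_iff).1 he; omega
  rcases CF.at_most_two hφ k0 k1 k2 k0a k0b k1a k1b k2a k2b with e | e | e
  · exact d01 (h.eq_of_tset_eq (hm 0 h0).1 (hm 1 h1).1 e)
  · exact d02 (h.eq_of_tset_eq (hm 0 h0).1 (hm 2 h2).1 e)
  · exact d12 (h.eq_of_tset_eq (hm 1 h1).1 (hm 2 h2).1 e)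

/-- **Side count two: every triangle of `M` on the image side is placed.** [folklore] -/
theorem placed_of_gsc_two (h : Realizes M φ s) {a b : ℕ} (ha : a < s.n) (hb : b < s.n) (hab : a ≠ b)
    (h2 : s.gsc a b = 2) {S : Finset (Fin 12)} (hS : S ∈ M.tri) (haS : φ a ∈ S) (hbS : φ b ∈ S) :
    ∃ t ∈ s.tris.toList, tset φ t = S := by
  unfold St.gsc at h2
  obtain ⟨t1, t2, he⟩ := List.length_eq_two.1 h2
  have hnd : (s.tris.toList.filter fun t => tmem t a && tmem t b).Nodup := h.nodup.filter _
  rw [he] at hnd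
  have d12 : t1 ≠ t2 := by simpa using hnd
  have hm1 : t1 ∈ s.tris.toList.filter fun t => tmem t a && tmem t b := by rw [he]; simp
  have hm2 : t2 ∈ s.tris.toList.filter fun t => tmem t a && tmem t b := by rw [he]; simp
  rw [List.mem_filter, Bool.and_eq_true] at hm1 hm2
  have hφ : φ a ≠ φ b := fun he => hab (h.inj a b ha hb he)
  have k1 := h.mem _ hm1.1
  have k2 := h.mem _ hm2.1
  have a1 := (h.mem_tset_iff hm1.1 ha).2 (tmem_iff.1 hm1.2.1)
  have b1 := (h.mem_tset_iff hm1.1 hb).2 (tmem_iff.1 hm1.2.2)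
  have a2 := (h.mem_tset_iff hm2.1 ha).2 (tmem_iff.1 hm2.2.1)
  have b2 := (h.mem_tset_iff hm2.1 hb).2 (tmem_iff.1 hm2.2.2)
  rcases CF.at_most_two hφ k1 k2 hS a1 b1 a2 b2 haS hbS with e | e | e
  · exact absurd (h.eq_of_tset_eq hm1.1 hm2.1 e) d12
  · exact ⟨t1, hm1.1, e⟩
  · exact ⟨t2, hm2.1, e⟩

/-- **Side count one: a triangle of `M` on the image side is not placed.** [folklore] -/
theorem exists_unplaced_of_gsc_one (h : Realizes M φ s) {a b : ℕ} (ha : a < s.n) (hb : b < s.n) (hab : a ≠ b)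
    (h1 : s.gsc a b = 1) :
    ∃ S ∈ M.tri, φ a ∈ S ∧ φ b ∈ S ∧ ∀ t ∈ s.tris.toList, tset φ t ≠ S := by
  unfold St.gsc at h1
  obtain ⟨t1, he⟩ := List.length_eq_one_iff.1 h1
  have hm1 : t1 ∈ s.tris.toList.filter fun t => tmem t a && tmem t b := by rw [he]; simp
  rw [List.mem_filter, Bool.and_eq_true] at hm1
  have hφ : φ a ≠ φ b := fun he => hab (h.inj a b ha hb he)
  have a1 := (h.mem_tset_iff hm1.1 ha).2 (tmem_iff.1 hm1.2.1)
  have b1 := (h.mem_tset_iff hm1.1 hb).2 (tmem_iff.1 hm1.2.2)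
  obtain ⟨S, hS, hne, haS, hbS⟩ := CF.exists_second hφ (h.mem _ hm1.1) a1 b1
  refine ⟨S, hS, haS, hbS, fun t ht he' => ?_⟩
  -- t would be a second element of the filter
  have hta : tmem t a = true := tmem_iff.2 ((h.mem_tset_iff ht ha).1 (he' ▸ haS))
  have htb : tmem t b = true := tmem_iff.2 ((h.mem_tset_iff ht hb).1 (he' ▸ hbS))
  have : t ∈ s.tris.toList.filter fun t => tmem t a && tmem t b := by
    rw [List.mem_filter]; exact ⟨ht, by simp [hta, htb]⟩
  rw [he, List.mem_singleton] at this
  subst this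
  exact hne he'.symm

/-- **Closing a label is sound**: if every link label of a used label `v` has side count two with
`v`, the whole star of `φ v` is placed. [folklore] -/
theorem star_placed (h : Realizes M φ s) {v : ℕ} (hv : v < s.n)
    (htwo : ∀ u, u < s.n → u ≠ v → s.gsc v u ≠ 0 → s.gsc v u = 2) :
    ∀ T ∈ M.tri, φ v ∈ T → ∃ t ∈ s.tris.toList, tset φ t = T := by
  classical
  -- A := images of the placed triangles at v
  set A : Finset (Finset (Fin 12)) := ((s.tris.toList.filter fun t => tmem t v).map (tset φ)).toFinset with hA
  have hAmem : ∀ T, T ∈ A ↔ ∃ t ∈ s.tris.toList, tmem t v = true ∧ tset φ t = T := by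
    intro T; rw [hA]; simp [List.mem_filter, and_assoc]
  have hAsub : A ⊆ M.star (φ v) := by
    intro T hT
    obtain ⟨t, ht, htv, rfl⟩ := (hAmem T).1 hT
    exact CF.mem_star.2 ⟨h.mem t ht, (h.mem_tset_iff ht hv).2 (tmem_iff.1 htv)⟩
  have hAne : A.Nonempty := by
    obtain ⟨t, ht, htv⟩ := h.used v hv
    exact ⟨tset φ t, (hAmem _).2 ⟨t, ht, htv, rfl⟩⟩
  have hAeq : A = M.star (φ v) := by
    refine CF.star_eq_of_closed hAsub hAne ?_
    intro T hT w hwT hwv S' hS' hvS' hwS'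
    obtain ⟨t, ht, htv, rfl⟩ := (hAmem T).1 hT
    obtain ⟨w', hw', rfl⟩ := exists_label_of_mem_tset hwT
    have hw'n : w' < s.n := h.lt_n ht hw'
    have hw'v : w' ≠ v := fun e => hwv (by rw [e])
    have hne0 : s.gsc v w' ≠ 0 := gsc_ne_zero_of_mem ht htv (tmem_iff.2 hw')
    have h2 := htwo w' hw'n hw'v hne0
    obtain ⟨t', ht', he'⟩ := h.placed_of_gsc_two hv hw'n (Ne.symm hw'v) h2 hS' hvS' hwS'
    refine (hAmem S').2 ⟨t', ht', ?_, he'⟩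
    exact tmem_iff.2 ((h.mem_tset_iff ht' hv).1 (he' ▸ hvS'))
  intro T hT hvT
  have : T ∈ A := by rw [hAeq]; exact CF.mem_star.2 ⟨hT, hvT⟩
  obtain ⟨t, ht, -, he⟩ := (hAmem T).1 this
  exact ⟨t, ht, he⟩

/-- The placed triangles at a used label inject into the star of its image, so the star is at
least as large; with an open spoke it is strictly larger. [folklore] -/
theorem card_star_ge (h : Realizes M φ s) {v : ℕ} (hv : v < s.n) :
    (s.trisAt v).length + (if s.hasOpen v then 1 else 0) ≤ (M.star (φ v)).card := by
  classical
  rw [← trisAt_eq]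
  set L := s.tris.toList.filter fun t => tmem t v with hL
  have hnd : L.Nodup := h.nodup.filter _
  have himg : ∀ t ∈ L, tset φ t ∈ M.star (φ v) := by
    intro t ht
    rw [hL, List.mem_filter] at ht
    exact CF.mem_star.2 ⟨h.mem t ht.1, (h.mem_tset_iff ht.1 hv).2 (tmem_iff.1 ht.2)⟩
  have hinj : ∀ t ∈ L, ∀ t' ∈ L, tset φ t = tset φ t' → t = t' := by
    intro t ht t' ht' he
    rw [hL, List.mem_filter] at ht ht'
    exact h.eq_of_tset_eq ht.1 ht'.1 he
  have hcard : L.length = (L.toFinset.image (tset φ)).card := by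
    rw [card_image_of_injOn, List.toFinset_card_of_nodup hnd]
    intro t ht t' ht' he
    exact hinj t (by simpa using ht) t' (by simpa using ht') he
  have hsub : L.toFinset.image (tset φ) ⊆ M.star (φ v) := by
    intro T hT
    rw [mem_image] at hT
    obtain ⟨t, ht, rfl⟩ := hT
    exact himg t (by simpa using ht)
  split_ifs with hop
  · -- an extra unplaced triangle of the star
    unfold St.hasOpen at hop
    rw [List.any_eq_true] at hop
    obtain ⟨u, hu, hu'⟩ := hop
    simp only [Bool.and_eq_true, bne_iff_ne, ne_eq, beq_iff_eq] at hu'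
    have hun : u < s.n := by simpa using hu
    obtain ⟨S, hS, hvS, huS, hnot⟩ := h.exists_unplaced_of_gsc_one hv hun (Ne.symm hu'.1) hu'.2
    have hSstar : S ∈ M.star (φ v) := CF.mem_star.2 ⟨hS, hvS⟩
    have hSnot : S ∉ L.toFinset.image (tset φ) := by
      rw [mem_image]
      rintro ⟨t, ht, he⟩
      have ht' : t ∈ L := by simpa using ht
      rw [hL, List.mem_filter] at ht'
      exact hnot t ht'.1 he
    have := card_lt_card (Finset.ssubset_iff_subset_ne.2 ⟨hsub, fun he => hSnot (he ▸ hSstar)⟩)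
    omega
  · have := card_le_card hsub
    omega

/-- Used labels of a closed star: the star size is the number of placed triangles at the label.
[folklore] -/
theorem card_star_eq_of_placed (h : Realizes M φ s) {v : ℕ} (hv : v < s.n)
    (hall : ∀ T ∈ M.tri, φ v ∈ T → ∃ t ∈ s.tris.toList, tset φ t = T) :
    (M.star (φ v)).card = (s.trisAt v).length := by
  classical
  rw [← trisAt_eq]
  set L := s.tris.toList.filter fun t => tmem t v with hL
  have hnd : L.Nodup := h.nodup.filter _
  have heq : L.toFinset.image (tset φ) = M.star (φ v) := by
    ext T
    rw [mem_image]
    constructor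
    · rintro ⟨t, ht, rfl⟩
      have ht' : t ∈ L := by simpa using ht
      rw [hL, List.mem_filter] at ht'
      exact CF.mem_star.2 ⟨h.mem t ht'.1, (h.mem_tset_iff ht'.1 hv).2 (tmem_iff.1 ht'.2)⟩
    · intro hT
      obtain ⟨hT1, hT2⟩ := CF.mem_star.1 hT
      obtain ⟨t, ht, rfl⟩ := hall T hT1 hT2
      refine ⟨t, ?_, rfl⟩
      have : t ∈ L := by
        rw [hL, List.mem_filter]
        exact ⟨ht, tmem_iff.2 ((h.mem_tset_iff ht hv).1 hT2)⟩
      simpa using this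
  rw [← heq, card_image_of_injOn, List.toFinset_card_of_nodup hnd]
  intro t ht t' ht' he
  have ht1 : t ∈ L := by simpa using ht
  have ht1' : t' ∈ L := by simpa using ht'
  rw [hL, List.mem_filter] at ht1 ht1'
  exact h.eq_of_tset_eq ht1.1 ht1'.1 he

end Realizes

end ShellCensusSearch

end Literature.Geometry.DiscreteGeometry
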